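import Summits.CriticalPhenomena.PercolationContinuityZ3.Theorems.PercNearOneGluingNoHeavyLowerTailSahiOneStepTwoLumpFreeBlock
import Summits.CriticalPhenomena.PercolationContinuityZ3.Theorems.PercNearOneGluingNoHeavyLowerTailSahiOneStepFreeStep
import HarnessLib

/-!
# Two-sided lumping with a free block — support form (coordinates of the determining set outside the slot block)

Support file (prover prim-ineq-prove-3 gen 53; `--supports stmt-CriticalPhenomena-4575`; memo
`run/shared/lean/prim/prim-ineq-prove-3/PROOF-G53-TL-FREE-BLOCK.md` §6).  No definitions, no named facts, no sorries, no `native_decide`.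

* `twoLump_free_split` — splitting identity for `Ψ` (gen 50's two-sided lumping functional, written out, with abstract events `T ⊇ V`
  determined by the coordinates `≠ e`) along a coordinate `e`, for increasing `A, B`:
  `Ψ(A,B) = p²Ψ(A¹,B¹) + q²Ψ(A⁰,B⁰) + pq(Ψ(A¹,B⁰) + Ψ(A⁰,B¹)) + (1−μT)μV·pq·(μ(T∩D) − μ(V∩D))`, `D = (A¹∖A⁰) ∩ (B¹∖B⁰)` (`Ψ` is bilinear);
* `twoLump_nonneg_of_sections` — hence the FREE-COORDINATE STEP: the four mixed section pairs `≥ 0` give `Ψ(A,B) ≥ 0` (`V ⊆ T`);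
* **`twoLump_threshold_nonneg_of_const_on_support`** — slot block `S`, levels `t ≤ s`, `A, B` increasing and `D`-determined, density constant
  `P ∈ (0,1)` on `D ∩ S` and arbitrary in `(0,1)` on `S ∖ D` (arbitrary on `D ∖ S` and elsewhere): `0 ≤ Ψ_{Th_t S, Th_s S}(A,B)` — i.e. two-sided
  lumping holds whenever the density is constant on `(supp A ∪ supp B) ∩ S`.  From THEOREM TL-FREE (`twoLump_threshold_nonneg_of_const_freeBlock`).
-/

noncomputable section

namespace Summit.CriticalPhenomena.PercolationContinuityZ3.Theorems

namespace SahiOneStep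

open MeasureTheory Finset
open Literature.Probability.Percolation (DeterminedBy determinedBy_iff)
open Literature.Probability.LatticeModels (prodBernoulli)
open Literature.Probability.Percolation.DecisionTree (ind)
open SahiE3Sections (determinedBy_section_insert determinedBy_section_sdiff)
open scoped Classical

variable {ι : Type*} [Fintype ι]

/-- **Splitting identity for `Ψ` along a coordinate `e` free for `T, V`** (increasing `A, B`). [this work] -/
theorem twoLump_free_split (p : ι → unitInterval) {T V : Set (Set ι)} (e : ι)
    (hT : DeterminedBy T ((({e} : Finset ι) : Set ι)ᶜ)) (hV : DeterminedBy V ((({e} : Finset ι) : Set ι)ᶜ))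
    {A B : Set (Set ι)} (hA : IsUpperSet A) (hB : IsUpperSet B) :
    (1 - (prodBernoulli p).real T) * (prodBernoulli p).real V *
        ((prodBernoulli p).real (T ∩ A ∩ B) - (prodBernoulli p).real (V ∩ A ∩ B))
    + (prodBernoulli p).real V * ((prodBernoulli p).real A - (prodBernoulli p).real (T ∩ A)) * ((prodBernoulli p).real B - (prodBernoulli p).real (T ∩ B))
    + (1 - (prodBernoulli p).real T) * (prodBernoulli p).real (V ∩ A) * (prodBernoulli p).real (V ∩ B)
    - (1 - (prodBernoulli p).real T) * (prodBernoulli p).real V * (prodBernoulli p).real A * (prodBernoulli p).real B =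
      (p e : ℝ) ^ 2 * ((1 - (prodBernoulli p).real T) * (prodBernoulli p).real V *
            ((prodBernoulli p).real (T ∩ {ω : Set ι | insert e ω ∈ A} ∩ {ω : Set ι | insert e ω ∈ B}) - (prodBernoulli p).real (V ∩ {ω : Set ι | insert e ω ∈ A} ∩ {ω : Set ι | insert e ω ∈ B}))
        + (prodBernoulli p).real V * ((prodBernoulli p).real {ω : Set ι | insert e ω ∈ A} - (prodBernoulli p).real (T ∩ {ω : Set ι | insert e ω ∈ A})) * ((prodBernoulli p).real {ω : Set ι | insert e ω ∈ B} - (prodBernoulli p).real (T ∩ {ω : Set ι | insert e ω ∈ B}))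
        + (1 - (prodBernoulli p).real T) * (prodBernoulli p).real (V ∩ {ω : Set ι | insert e ω ∈ A}) * (prodBernoulli p).real (V ∩ {ω : Set ι | insert e ω ∈ B})
        - (1 - (prodBernoulli p).real T) * (prodBernoulli p).real V * (prodBernoulli p).real {ω : Set ι | insert e ω ∈ A} * (prodBernoulli p).real {ω : Set ι | insert e ω ∈ B})
      + (1 - p e) ^ 2 * ((1 - (prodBernoulli p).real T) * (prodBernoulli p).real V *
            ((prodBernoulli p).real (T ∩ {ω : Set ι | ω \ {e} ∈ A} ∩ {ω : Set ι | ω \ {e} ∈ B}) - (prodBernoulli p).real (V ∩ {ω : Set ι | ω \ {e} ∈ A} ∩ {ω : Set ι | ω \ {e} ∈ B}))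
        + (prodBernoulli p).real V * ((prodBernoulli p).real {ω : Set ι | ω \ {e} ∈ A} - (prodBernoulli p).real (T ∩ {ω : Set ι | ω \ {e} ∈ A})) * ((prodBernoulli p).real {ω : Set ι | ω \ {e} ∈ B} - (prodBernoulli p).real (T ∩ {ω : Set ι | ω \ {e} ∈ B}))
        + (1 - (prodBernoulli p).real T) * (prodBernoulli p).real (V ∩ {ω : Set ι | ω \ {e} ∈ A}) * (prodBernoulli p).real (V ∩ {ω : Set ι | ω \ {e} ∈ B})
        - (1 - (prodBernoulli p).real T) * (prodBernoulli p).real V * (prodBernoulli p).real {ω : Set ι | ω \ {e} ∈ A} * (prodBernoulli p).real {ω : Set ι | ω \ {e} ∈ B})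
      + (p e : ℝ) * (1 - p e) * (((1 - (prodBernoulli p).real T) * (prodBernoulli p).real V *
              ((prodBernoulli p).real (T ∩ {ω : Set ι | insert e ω ∈ A} ∩ {ω : Set ι | ω \ {e} ∈ B}) - (prodBernoulli p).real (V ∩ {ω : Set ι | insert e ω ∈ A} ∩ {ω : Set ι | ω \ {e} ∈ B}))
          + (prodBernoulli p).real V * ((prodBernoulli p).real {ω : Set ι | insert e ω ∈ A} - (prodBernoulli p).real (T ∩ {ω : Set ι | insert e ω ∈ A})) * ((prodBernoulli p).real {ω : Set ι | ω \ {e} ∈ B} - (prodBernoulli p).real (T ∩ {ω : Set ι | ω \ {e} ∈ B}))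
          + (1 - (prodBernoulli p).real T) * (prodBernoulli p).real (V ∩ {ω : Set ι | insert e ω ∈ A}) * (prodBernoulli p).real (V ∩ {ω : Set ι | ω \ {e} ∈ B})
          - (1 - (prodBernoulli p).real T) * (prodBernoulli p).real V * (prodBernoulli p).real {ω : Set ι | insert e ω ∈ A} * (prodBernoulli p).real {ω : Set ι | ω \ {e} ∈ B})
        + ((1 - (prodBernoulli p).real T) * (prodBernoulli p).real V *
              ((prodBernoulli p).real (T ∩ {ω : Set ι | ω \ {e} ∈ A} ∩ {ω : Set ι | insert e ω ∈ B}) - (prodBernoulli p).real (V ∩ {ω : Set ι | ω \ {e} ∈ A} ∩ {ω : Set ι | insert e ω ∈ B}))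
          + (prodBernoulli p).real V * ((prodBernoulli p).real {ω : Set ι | ω \ {e} ∈ A} - (prodBernoulli p).real (T ∩ {ω : Set ι | ω \ {e} ∈ A})) * ((prodBernoulli p).real {ω : Set ι | insert e ω ∈ B} - (prodBernoulli p).real (T ∩ {ω : Set ι | insert e ω ∈ B}))
          + (1 - (prodBernoulli p).real T) * (prodBernoulli p).real (V ∩ {ω : Set ι | ω \ {e} ∈ A}) * (prodBernoulli p).real (V ∩ {ω : Set ι | insert e ω ∈ B})
          - (1 - (prodBernoulli p).real T) * (prodBernoulli p).real V * (prodBernoulli p).real {ω : Set ι | ω \ {e} ∈ A} * (prodBernoulli p).real {ω : Set ι | insert e ω ∈ B}))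
      + (1 - (prodBernoulli p).real T) * (prodBernoulli p).real V * ((p e : ℝ) * (1 - p e)) *
        ((prodBernoulli p).real (T ∩ ({ω : Set ι | insert e ω ∈ A} \ {ω : Set ι | ω \ {e} ∈ A}) ∩ ({ω : Set ι | insert e ω ∈ B} \ {ω : Set ι | ω \ {e} ∈ B}))
          - (prodBernoulli p).real (V ∩ ({ω : Set ι | insert e ω ∈ A} \ {ω : Set ι | ω \ {e} ∈ A}) ∩ ({ω : Set ι | insert e ω ∈ B} \ {ω : Set ι | ω \ {e} ∈ B}))) := by
  set μ := prodBernoulli p with hμ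
  set A1 : Set (Set ι) := {ω : Set ι | insert e ω ∈ A} with hA1
  set A0 : Set (Set ι) := {ω : Set ι | ω \ {e} ∈ A} with hA0
  set B1 : Set (Set ι) := {ω : Set ι | insert e ω ∈ B} with hB1
  set B0 : Set (Set ι) := {ω : Set ι | ω \ {e} ∈ B} with hB0
  have hA01 : A0 ⊆ A1 := section_sdiff_subset_section_insert hA e
  have hB01 : B0 ⊆ B1 := section_sdiff_subset_section_insert hB e
  have eT1 : μ.real (T ∩ A ∩ B) = (p e : ℝ) * μ.real (T ∩ A1 ∩ B1) + (1 - p e) * μ.real (T ∩ A0 ∩ B0) := by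
    rw [Set.inter_assoc, real_inter_split_free p e hT (A ∩ B), section_insert_inter, section_sdiff_inter, ← Set.inter_assoc,
      ← Set.inter_assoc]
  have eV1 : μ.real (V ∩ A ∩ B) = (p e : ℝ) * μ.real (V ∩ A1 ∩ B1) + (1 - p e) * μ.real (V ∩ A0 ∩ B0) := by
    rw [Set.inter_assoc, real_inter_split_free p e hV (A ∩ B), section_insert_inter, section_sdiff_inter, ← Set.inter_assoc,
      ← Set.inter_assoc]
  have eT2 : μ.real (T ∩ A) = (p e : ℝ) * μ.real (T ∩ A1) + (1 - p e) * μ.real (T ∩ A0) := real_inter_split_free p e hT A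
  have eT3 : μ.real (T ∩ B) = (p e : ℝ) * μ.real (T ∩ B1) + (1 - p e) * μ.real (T ∩ B0) := real_inter_split_free p e hT B
  have eV2 : μ.real (V ∩ A) = (p e : ℝ) * μ.real (V ∩ A1) + (1 - p e) * μ.real (V ∩ A0) := real_inter_split_free p e hV A
  have eV3 : μ.real (V ∩ B) = (p e : ℝ) * μ.real (V ∩ B1) + (1 - p e) * μ.real (V ∩ B0) := real_inter_split_free p e hV B
  have e4 : μ.real A = (p e : ℝ) * μ.real A1 + (1 - p e) * μ.real A0 := real_split p e A
  have e5 : μ.real B = (p e : ℝ) * μ.real B1 + (1 - p e) * μ.real B0 := real_split p e B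
  have e6 : ∀ H : Set (Set ι), μ.real (H ∩ (A1 \ A0) ∩ (B1 \ B0)) =
      μ.real (H ∩ A1 ∩ B1) - μ.real (H ∩ A1 ∩ B0) - μ.real (H ∩ A0 ∩ B1) + μ.real (H ∩ A0 ∩ B0) := by
    intro H
    have s1 : H ∩ (A1 \ A0) ∩ (B1 \ B0) = (H ∩ A1 ∩ (B1 \ B0)) \ (H ∩ A0 ∩ (B1 \ B0)) := by
      ext ω; simp only [Set.mem_inter_iff, Set.mem_sdiff]; tauto
    have s1' : H ∩ A0 ∩ (B1 \ B0) ⊆ H ∩ A1 ∩ (B1 \ B0) := fun ω hω => ⟨⟨hω.1.1, hA01 hω.1.2⟩, hω.2⟩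
    have s2 : ∀ C : Set (Set ι), H ∩ C ∩ (B1 \ B0) = (H ∩ C ∩ B1) \ (H ∩ C ∩ B0) := fun C => by
      ext ω; simp only [Set.mem_inter_iff, Set.mem_sdiff]; tauto
    have s2' : ∀ C : Set (Set ι), H ∩ C ∩ B0 ⊆ H ∩ C ∩ B1 := fun C ω hω => ⟨hω.1, hB01 hω.2⟩
    rw [s1, measureReal_sdiff s1' MeasurableSet.of_discrete, s2 A1, s2 A0, measureReal_sdiff (s2' A1) MeasurableSet.of_discrete,
      measureReal_sdiff (s2' A0) MeasurableSet.of_discrete]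
    ring
  rw [eT1, eV1, eT2, eT3, eV2, eV3, e4, e5, e6 T, e6 V]
  ring

/-- **Free-coordinate step for `Ψ`.**  `V ⊆ T` determined by the coordinates `≠ e`, `A, B` increasing: if the four mixed pairs of sections at
`e` have `Ψ ≥ 0`, then `Ψ(A,B) ≥ 0` (the remainder of `twoLump_free_split` is nonnegative). [this work] -/
theorem twoLump_nonneg_of_sections (p : ι → unitInterval) {T V : Set (Set ι)} (e : ι)
    (hT : DeterminedBy T ((({e} : Finset ι) : Set ι)ᶜ)) (hV : DeterminedBy V ((({e} : Finset ι) : Set ι)ᶜ)) (hVT : V ⊆ T)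
    {A B : Set (Set ι)} (hA : IsUpperSet A) (hB : IsUpperSet B)
    (n11 : 0 ≤ (1 - (prodBernoulli p).real T) * (prodBernoulli p).real V *
          ((prodBernoulli p).real (T ∩ {ω : Set ι | insert e ω ∈ A} ∩ {ω : Set ι | insert e ω ∈ B}) - (prodBernoulli p).real (V ∩ {ω : Set ι | insert e ω ∈ A} ∩ {ω : Set ι | insert e ω ∈ B}))
      + (prodBernoulli p).real V * ((prodBernoulli p).real {ω : Set ι | insert e ω ∈ A} - (prodBernoulli p).real (T ∩ {ω : Set ι | insert e ω ∈ A})) * ((prodBernoulli p).real {ω : Set ι | insert e ω ∈ B} - (prodBernoulli p).real (T ∩ {ω : Set ι | insert e ω ∈ B}))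
      + (1 - (prodBernoulli p).real T) * (prodBernoulli p).real (V ∩ {ω : Set ι | insert e ω ∈ A}) * (prodBernoulli p).real (V ∩ {ω : Set ι | insert e ω ∈ B})
      - (1 - (prodBernoulli p).real T) * (prodBernoulli p).real V * (prodBernoulli p).real {ω : Set ι | insert e ω ∈ A} * (prodBernoulli p).real {ω : Set ι | insert e ω ∈ B})
    (n00 : 0 ≤ (1 - (prodBernoulli p).real T) * (prodBernoulli p).real V *
          ((prodBernoulli p).real (T ∩ {ω : Set ι | ω \ {e} ∈ A} ∩ {ω : Set ι | ω \ {e} ∈ B}) - (prodBernoulli p).real (V ∩ {ω : Set ι | ω \ {e} ∈ A} ∩ {ω : Set ι | ω \ {e} ∈ B}))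
      + (prodBernoulli p).real V * ((prodBernoulli p).real {ω : Set ι | ω \ {e} ∈ A} - (prodBernoulli p).real (T ∩ {ω : Set ι | ω \ {e} ∈ A})) * ((prodBernoulli p).real {ω : Set ι | ω \ {e} ∈ B} - (prodBernoulli p).real (T ∩ {ω : Set ι | ω \ {e} ∈ B}))
      + (1 - (prodBernoulli p).real T) * (prodBernoulli p).real (V ∩ {ω : Set ι | ω \ {e} ∈ A}) * (prodBernoulli p).real (V ∩ {ω : Set ι | ω \ {e} ∈ B})
      - (1 - (prodBernoulli p).real T) * (prodBernoulli p).real V * (prodBernoulli p).real {ω : Set ι | ω \ {e} ∈ A} * (prodBernoulli p).real {ω : Set ι | ω \ {e} ∈ B})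
    (n10 : 0 ≤ (1 - (prodBernoulli p).real T) * (prodBernoulli p).real V *
          ((prodBernoulli p).real (T ∩ {ω : Set ι | insert e ω ∈ A} ∩ {ω : Set ι | ω \ {e} ∈ B}) - (prodBernoulli p).real (V ∩ {ω : Set ι | insert e ω ∈ A} ∩ {ω : Set ι | ω \ {e} ∈ B}))
      + (prodBernoulli p).real V * ((prodBernoulli p).real {ω : Set ι | insert e ω ∈ A} - (prodBernoulli p).real (T ∩ {ω : Set ι | insert e ω ∈ A})) * ((prodBernoulli p).real {ω : Set ι | ω \ {e} ∈ B} - (prodBernoulli p).real (T ∩ {ω : Set ι | ω \ {e} ∈ B}))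
      + (1 - (prodBernoulli p).real T) * (prodBernoulli p).real (V ∩ {ω : Set ι | insert e ω ∈ A}) * (prodBernoulli p).real (V ∩ {ω : Set ι | ω \ {e} ∈ B})
      - (1 - (prodBernoulli p).real T) * (prodBernoulli p).real V * (prodBernoulli p).real {ω : Set ι | insert e ω ∈ A} * (prodBernoulli p).real {ω : Set ι | ω \ {e} ∈ B})
    (n01 : 0 ≤ (1 - (prodBernoulli p).real T) * (prodBernoulli p).real V *
          ((prodBernoulli p).real (T ∩ {ω : Set ι | ω \ {e} ∈ A} ∩ {ω : Set ι | insert e ω ∈ B}) - (prodBernoulli p).real (V ∩ {ω : Set ι | ω \ {e} ∈ A} ∩ {ω : Set ι | insert e ω ∈ B}))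
      + (prodBernoulli p).real V * ((prodBernoulli p).real {ω : Set ι | ω \ {e} ∈ A} - (prodBernoulli p).real (T ∩ {ω : Set ι | ω \ {e} ∈ A})) * ((prodBernoulli p).real {ω : Set ι | insert e ω ∈ B} - (prodBernoulli p).real (T ∩ {ω : Set ι | insert e ω ∈ B}))
      + (1 - (prodBernoulli p).real T) * (prodBernoulli p).real (V ∩ {ω : Set ι | ω \ {e} ∈ A}) * (prodBernoulli p).real (V ∩ {ω : Set ι | insert e ω ∈ B})
      - (1 - (prodBernoulli p).real T) * (prodBernoulli p).real V * (prodBernoulli p).real {ω : Set ι | ω \ {e} ∈ A} * (prodBernoulli p).real {ω : Set ι | insert e ω ∈ B}) :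
    0 ≤ (1 - (prodBernoulli p).real T) * (prodBernoulli p).real V *
          ((prodBernoulli p).real (T ∩ A ∩ B) - (prodBernoulli p).real (V ∩ A ∩ B))
      + (prodBernoulli p).real V * ((prodBernoulli p).real A - (prodBernoulli p).real (T ∩ A)) * ((prodBernoulli p).real B - (prodBernoulli p).real (T ∩ B))
      + (1 - (prodBernoulli p).real T) * (prodBernoulli p).real (V ∩ A) * (prodBernoulli p).real (V ∩ B)
      - (1 - (prodBernoulli p).real T) * (prodBernoulli p).real V * (prodBernoulli p).real A * (prodBernoulli p).real B := by
  rw [twoLump_free_split p e hT hV hA hB]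
  have hpe0 : 0 ≤ (p e : ℝ) := (p e).2.1
  have hpe1 : (p e : ℝ) ≤ 1 := (p e).2.2
  have hT1 : (prodBernoulli p).real T ≤ 1 := measureReal_le_one
  have hlast : 0 ≤ (prodBernoulli p).real (T ∩ ({ω : Set ι | insert e ω ∈ A} \ {ω : Set ι | ω \ {e} ∈ A}) ∩ ({ω : Set ι | insert e ω ∈ B} \ {ω : Set ι | ω \ {e} ∈ B}))
      - (prodBernoulli p).real (V ∩ ({ω : Set ι | insert e ω ∈ A} \ {ω : Set ι | ω \ {e} ∈ A}) ∩ ({ω : Set ι | insert e ω ∈ B} \ {ω : Set ι | ω \ {e} ∈ B})) :=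
    sub_nonneg.2 (measureReal_mono (Set.inter_subset_inter_left _ (Set.inter_subset_inter_left _ hVT)))
  have h1 := mul_nonneg (pow_nonneg hpe0 2) n11
  have h2 := mul_nonneg (pow_nonneg (sub_nonneg.2 hpe1) 2) n00
  have h3 := mul_nonneg (mul_nonneg hpe0 (sub_nonneg.2 hpe1)) (add_nonneg n10 n01)
  have hV0 : 0 ≤ (prodBernoulli p).real V := measureReal_nonneg
  have h4 := mul_nonneg (mul_nonneg (mul_nonneg (sub_nonneg.2 hT1) hV0) (mul_nonneg hpe0 (sub_nonneg.2 hpe1))) hlast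
  linarith

/-- **TWO-SIDED LUMPING, SUPPORT FORM**: slot block `S`, levels `t ≤ s`; `A, B` increasing and determined by a block `D`; density constant
`P ∈ (0,1)` on `D ∩ S` and arbitrary in `(0,1)` on `S ∖ D` (arbitrary on `D ∖ S` and elsewhere).  Then `0 ≤ Ψ_{Th_t S, Th_s S}(A, B)`: the coordinates
of `D` outside `S` are removed one at a time by `twoLump_nonneg_of_sections`, then THEOREM TL-FREE applies with `F = D ∩ S`, `E = S ∖ D`. [this work] -/
theorem twoLump_threshold_nonneg_of_const_on_support (p : ι → unitInterval) {P : ℝ} (hP0 : 0 < P) (hP1 : P < 1) (S D : Finset ι)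
    (hpD : ∀ i ∈ D ∩ S, (p i : ℝ) = P) (hpS : ∀ i ∈ S \ D, 0 < (p i : ℝ) ∧ (p i : ℝ) < 1) {t s : ℕ} (hts : t ≤ s) {A B : Set (Set ι)}
    (hA : IsUpperSet A) (hB : IsUpperSet B) (hAD : DeterminedBy A (↑D : Set ι)) (hBD : DeterminedBy B (↑D : Set ι)) :
    0 ≤ (1 - (prodBernoulli p).real {ω : Set ι | t ≤ (S.filter (· ∈ ω)).card}) * (prodBernoulli p).real {ω : Set ι | s ≤ (S.filter (· ∈ ω)).card} *
          ((prodBernoulli p).real ({ω : Set ι | t ≤ (S.filter (· ∈ ω)).card} ∩ A ∩ B) - (prodBernoulli p).real ({ω : Set ι | s ≤ (S.filter (· ∈ ω)).card} ∩ A ∩ B))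
      + (prodBernoulli p).real {ω : Set ι | s ≤ (S.filter (· ∈ ω)).card} * ((prodBernoulli p).real A - (prodBernoulli p).real ({ω : Set ι | t ≤ (S.filter (· ∈ ω)).card} ∩ A)) * ((prodBernoulli p).real B - (prodBernoulli p).real ({ω : Set ι | t ≤ (S.filter (· ∈ ω)).card} ∩ B))
      + (1 - (prodBernoulli p).real {ω : Set ι | t ≤ (S.filter (· ∈ ω)).card}) * (prodBernoulli p).real ({ω : Set ι | s ≤ (S.filter (· ∈ ω)).card} ∩ A) * (prodBernoulli p).real ({ω : Set ι | s ≤ (S.filter (· ∈ ω)).card} ∩ B)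
      - (1 - (prodBernoulli p).real {ω : Set ι | t ≤ (S.filter (· ∈ ω)).card}) * (prodBernoulli p).real {ω : Set ι | s ≤ (S.filter (· ∈ ω)).card} * (prodBernoulli p).real A * (prodBernoulli p).real B := by
  have hVT : {ω : Set ι | s ≤ (S.filter (· ∈ ω)).card} ⊆ {ω : Set ι | t ≤ (S.filter (· ∈ ω)).card} := fun ω hω => by
    simp only [Set.mem_setOf_eq] at hω ⊢; omega
  suffices key : ∀ (C : Finset ι), Disjoint C S → ∀ (A B : Set (Set ι)), IsUpperSet A → IsUpperSet B →
      DeterminedBy A (↑((D ∩ S) ∪ C) : Set ι) → DeterminedBy B (↑((D ∩ S) ∪ C) : Set ι) →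
      0 ≤ (1 - (prodBernoulli p).real {ω : Set ι | t ≤ (S.filter (· ∈ ω)).card}) * (prodBernoulli p).real {ω : Set ι | s ≤ (S.filter (· ∈ ω)).card} *
            ((prodBernoulli p).real ({ω : Set ι | t ≤ (S.filter (· ∈ ω)).card} ∩ A ∩ B) - (prodBernoulli p).real ({ω : Set ι | s ≤ (S.filter (· ∈ ω)).card} ∩ A ∩ B))
        + (prodBernoulli p).real {ω : Set ι | s ≤ (S.filter (· ∈ ω)).card} * ((prodBernoulli p).real A - (prodBernoulli p).real ({ω : Set ι | t ≤ (S.filter (· ∈ ω)).card} ∩ A)) * ((prodBernoulli p).real B - (prodBernoulli p).real ({ω : Set ι | t ≤ (S.filter (· ∈ ω)).card} ∩ B))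
        + (1 - (prodBernoulli p).real {ω : Set ι | t ≤ (S.filter (· ∈ ω)).card}) * (prodBernoulli p).real ({ω : Set ι | s ≤ (S.filter (· ∈ ω)).card} ∩ A) * (prodBernoulli p).real ({ω : Set ι | s ≤ (S.filter (· ∈ ω)).card} ∩ B)
        - (1 - (prodBernoulli p).real {ω : Set ι | t ≤ (S.filter (· ∈ ω)).card}) * (prodBernoulli p).real {ω : Set ι | s ≤ (S.filter (· ∈ ω)).card} * (prodBernoulli p).real A * (prodBernoulli p).real B by
    have hDS : (D ∩ S) ∪ (D \ S) = D := by
      ext i; simp only [Finset.mem_union, Finset.mem_inter, Finset.mem_sdiff]; tauto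
    exact key (D \ S) Finset.sdiff_disjoint A B hA hB (by rw [hDS]; exact hAD) (by rw [hDS]; exact hBD)
  intro C
  induction C using Finset.induction_on with
  | empty =>
    intro _ A B hA hB hAD hBD
    rw [Finset.union_empty] at hAD hBD
    have hS : (D ∩ S) ∪ (S \ D) = S := by
      ext i; simp only [Finset.mem_union, Finset.mem_inter, Finset.mem_sdiff]; tauto
    have h := twoLump_threshold_nonneg_of_const_freeBlock p hP0 hP1 (S \ D) hpS (D ∩ S)
      (Finset.disjoint_left.2 fun i hi hi' => (Finset.mem_sdiff.1 hi').2 (Finset.mem_inter.1 hi).1) hpD t s hts hA hB hAD hBD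
    rwa [hS] at h
  | insert c C hcC ih =>
    intro hdisj A B hA hB hAD hBD
    have hcS : c ∉ S := Finset.disjoint_left.1 hdisj (Finset.mem_insert_self c C)
    have hdisj' : Disjoint C S := Finset.disjoint_of_subset_left (Finset.subset_insert c C) hdisj
    have hcoe : (↑((D ∩ S) ∪ insert c C) : Set ι) \ {c} = ↑((D ∩ S) ∪ C) := by
      ext i
      simp only [Set.mem_sdiff, Finset.mem_coe, Finset.mem_union, Finset.mem_inter, Finset.mem_insert, Set.mem_singleton_iff]
      constructor
      · rintro ⟨h | rfl | h, hne⟩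
        · exact Or.inl h
        · exact absurd rfl hne
        · exact Or.inr h
      · rintro (h | h)
        · exact ⟨Or.inl h, fun hic => hcS (hic ▸ h.2)⟩
        · exact ⟨Or.inr (Or.inr h), fun hic => hcC (hic ▸ h)⟩
    refine twoLump_nonneg_of_sections p c (determinedBy_threshold_compl_singleton S t hcS)
      (determinedBy_threshold_compl_singleton S s hcS) hVT hA hB ?_ ?_ ?_ ?_
    · exact ih hdisj' _ _ (isUpperSet_section_insert hA c) (isUpperSet_section_insert hB c)
        (hcoe ▸ determinedBy_section_insert hAD c) (hcoe ▸ determinedBy_section_insert hBD c)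
    · exact ih hdisj' _ _ (isUpperSet_section_sdiff hA c) (isUpperSet_section_sdiff hB c)
        (hcoe ▸ determinedBy_section_sdiff hAD c) (hcoe ▸ determinedBy_section_sdiff hBD c)
    · exact ih hdisj' _ _ (isUpperSet_section_insert hA c) (isUpperSet_section_sdiff hB c)
        (hcoe ▸ determinedBy_section_insert hAD c) (hcoe ▸ determinedBy_section_sdiff hBD c)
    · exact ih hdisj' _ _ (isUpperSet_section_sdiff hA c) (isUpperSet_section_insert hB c)
        (hcoe ▸ determinedBy_section_sdiff hAD c) (hcoe ▸ determinedBy_section_insert hBD c)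

end SahiOneStep

end Summit.CriticalPhenomena.PercolationContinuityZ3.Theorems
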